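import Literature.Analysis.FluidPDE.NSCriticalClosureTao
import Literature.Analysis.FluidPDE.WeakGradientOfL2Limit
import HarnessLib

/-!
# Leray–Hopf solutions as uniform `L²` limits of smooth bounded-enstrophy solutions

Analysis/FluidPDE proof file (no named facts). Let `uⁿ` be classical solutions of the
Navier–Stokes system on `[0, T] × ℝ³` in the class of Tao 2013, Thm. 5.4 (smooth, all spatial
Sobolev norms of `uⁿ` and of the pressure bounded on `[0, T]`, `uⁿ ∈ C([0,T]; L²)`), with
uniformly bounded energy and enstrophy, which are Cauchy in `C([0,T]; L²)` and whose data converge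
in `L²` to `u₀`. Then the (a.e. pointwise) limit `v` is a Leray–Hopf weak solution on `[0, T)` from
`u₀`, with `v 0 = u₀` and `uⁿ(t) → v(t)` in `L²` for every `t ∈ [0, T]`
(`exists_isLerayHopfOn_of_uniform_limit`). This is the limit step in the approximation proof of
Tao 2013, Thm. 5.4 (ii) for `H¹` data (Robinson–Rodrigo–Sadowski 2016, proof of Thm. 4.10 /
Thm. 6.8: Galerkin/smooth approximations, uniform bounds, passage to the limit in the weak
formulation, energy inequality by lower semicontinuity; Ożański–Pooley 2018, proof of Thm. 6.37,
Steps 3–4). The weak formulation is pressure-free and linear in the test field, so uniform strong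
`L²` convergence suffices for every term; the dissipation passes to the limit by the Fatou-type
bound of `exists_hasWeakGradient_of_tendsto_eLpNorm`, the kinetic energies by the tree's
`tendsto_kineticEnergy_of_tendsto_eLpNorm_sub`.

## References

* J. C. Robinson, J. L. Rodrigo, W. Sadowski, *The three-dimensional Navier–Stokes equations*,
  CUP 2016, proof of Thm. 4.10 and Thm. 6.8. [RobinsonRodrigoSadowski2016]
* W. S. Ożański, B. C. Pooley, LMS Lecture Notes 452, CUP 2018, proof of Thm. 6.37, Steps 3–4.
  [OzanskiPooley2018]
* T. Tao, Localisation and compactness properties of the Navier–Stokes global regularity problem,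
  Anal. PDE 6 (2013), Thm. 5.4. [Tao2011]
-/

noncomputable section

open MeasureTheory TopologicalSpace Set Function Filter Topology ContinuousLinearMap
open scoped InnerProductSpace RealInnerProductSpace ENNReal NNReal Laplacian

namespace Literature.Analysis.FluidPDE

local notation "E3" => EuclideanSpace ℝ (Fin 3)

/-! ## The Tao class: energy equality and integrability -/

section TaoClass

variable {ν T : ℝ} {u : ℝ → E3 → E3} {p : ℝ → E3 → ℝ}

/-- `∫⁻ ‖u(t)‖ₑ² ≤ C₀` on `[0, T]` from the order-zero Sobolev bound. [folklore] -/
theorem lintegral_enorm_sq_le_of_hasBoundedSobolevNormsOn (hu : HasBoundedSobolevNormsOn (Icc 0 T) u) :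
    ∃ C₀ : ℝ≥0, ∀ t ∈ Icc 0 T, ∫⁻ x, ‖u t x‖ₑ ^ 2 ≤ C₀ := by
  obtain ⟨C₀, hC₀⟩ := hu 0
  exact ⟨C₀, fun t ht => (le_of_eq (lintegral_congr fun x => by
    rw [← ofReal_norm, ← norm_iteratedFDeriv_zero (𝕜 := ℝ) (f := u t), ofReal_norm])).trans (hC₀ t ht)⟩

/-- **Energy equality in the Tao class** (Tao 2013, Thm. 5.4 (i): smooth `H¹`/`H^∞` solutions
satisfy the energy identity; here through the tree's `IsClassicalNSSolutionOn.energyEq`, whose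
integrability clauses follow from the bounded Sobolev norms as in
`isLerayHopfOn_of_hasBoundedSobolevNormsOn`): for `0 ≤ s ≤ t ≤ T`,
`½‖u(t)‖² + ν ∫ₛᵗ∫ |∇u|² = ½‖u(s)‖²`. [cite: Tao2011, Thm. 5.4 (i)] -/
theorem energyEq_of_hasBoundedSobolevNormsOn (hT : 0 < T)
    (hsol : FluidPDE.IsClassicalNSSolutionOn (Icc 0 T) ν 0 u p)
    (hu : HasBoundedSobolevNormsOn (Icc 0 T) u)
    (hp : ∀ n : ℕ, ∃ C : ℝ≥0, ∀ t ∈ Icc 0 T, ∫⁻ x, ‖iteratedFDeriv ℝ n (p t) x‖ₑ ^ 2 ≤ C)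
    (hc : FluidPDE.ContinuousInLpOn (Icc 0 T) 2 u) {s t : ℝ} (hs : 0 ≤ s) (hst : s ≤ t)
    (ht : t ≤ T) :
    VectorCalculus.kineticEnergy (u t) +
      ν * (∫⁻ τ in Ioo s t, ∫⁻ x, ENNReal.ofReal (FluidPDE.frobeniusNormSq (fderiv ℝ (u τ) x))).toReal =
      VectorCalculus.kineticEnergy (u s) := by
  obtain ⟨B, hB0, hB⟩ := exists_forall_norm_le_of_hasBoundedSobolevNormsOn hsol hu
  obtain ⟨C₀, hu0⟩ := lintegral_enorm_sq_le_of_hasBoundedSobolevNormsOn hu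
  obtain ⟨C₁, hC₁⟩ := hu 1
  obtain ⟨P₀, hP₀⟩ := hp 0
  have hvol : volume (Ioo (0 : ℝ) T) < ⊤ := by simp
  have hp0 : ∀ t ∈ Icc 0 T, ∫⁻ x, ‖p t x‖ₑ ^ 2 ≤ P₀ := fun t ht =>
    (le_of_eq (lintegral_congr fun x => by rw [← ofReal_norm, ← norm_iteratedFDeriv_zero (𝕜 := ℝ)
      (f := p t), ofReal_norm])).trans (hP₀ t ht)
  have hM : ∀ τ ∈ Icc 0 T, FluidPDE.eEnergy (u τ) ≤ (C₀ : ℝ≥0∞) := fun τ hτ => hu0 τ hτ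
  have hgrad : ∫⁻ t in Ioo 0 T, ∫⁻ x, ENNReal.ofReal (FluidPDE.frobeniusNormSq (fderiv ℝ (u t) x)) < ∞ := by
    have hle : ∀ t ∈ Icc 0 T,
        ∫⁻ x, ENNReal.ofReal (FluidPDE.frobeniusNormSq (fderiv ℝ (u t) x)) ≤ 3 * C₁ := by
      intro t ht
      calc ∫⁻ x, ENNReal.ofReal (FluidPDE.frobeniusNormSq (fderiv ℝ (u t) x))
          ≤ ∫⁻ x, 3 * ‖iteratedFDeriv ℝ 1 (u t) x‖ₑ ^ 2 := lintegral_mono fun x => by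
            rw [← ofReal_norm, norm_iteratedFDeriv_one, ofReal_norm]
            exact ofReal_frobeniusNormSq_le_three_mul_enorm_sq _
        _ = 3 * ∫⁻ x, ‖iteratedFDeriv ℝ 1 (u t) x‖ₑ ^ 2 := lintegral_const_mul' _ _ (by simp)
        _ ≤ 3 * C₁ := by gcongr; exact hC₁ t ht
    calc ∫⁻ t in Ioo 0 T, ∫⁻ x, ENNReal.ofReal (FluidPDE.frobeniusNormSq (fderiv ℝ (u t) x))
        ≤ ∫⁻ _ in Ioo 0 T, 3 * (C₁ : ℝ≥0∞) :=
          setLIntegral_mono' measurableSet_Ioo fun t ht => hle t (Ioo_subset_Icc_self ht)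
      _ < ⊤ := by
          rw [setLIntegral_const]
          exact ENNReal.mul_lt_top (ENNReal.mul_lt_top (by simp) ENNReal.coe_lt_top) hvol
  have hu₃ : ∫⁻ t in Ioo 0 T, ∫⁻ x, ‖u t x‖ₑ ^ (3 : ℕ) < ∞ := by
    have hle : ∀ t ∈ Icc 0 T, ∫⁻ x, ‖u t x‖ₑ ^ (3 : ℕ) ≤ ENNReal.ofReal B * C₀ := by
      intro t ht
      calc ∫⁻ x, ‖u t x‖ₑ ^ (3 : ℕ) ≤ ∫⁻ x, ENNReal.ofReal B * ‖u t x‖ₑ ^ 2 :=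
            lintegral_mono fun x => by
              rw [pow_succ, mul_comm]
              gcongr
              rw [← ofReal_norm]
              exact ENNReal.ofReal_le_ofReal (hB t ht x)
        _ = ENNReal.ofReal B * ∫⁻ x, ‖u t x‖ₑ ^ 2 := lintegral_const_mul' _ _ ENNReal.ofReal_ne_top
        _ ≤ ENNReal.ofReal B * C₀ := by gcongr; exact hu0 t ht
    calc ∫⁻ t in Ioo 0 T, ∫⁻ x, ‖u t x‖ₑ ^ (3 : ℕ)
        ≤ ∫⁻ _ in Ioo 0 T, ENNReal.ofReal B * (C₀ : ℝ≥0∞) :=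
          setLIntegral_mono' measurableSet_Ioo fun t ht => hle t (Ioo_subset_Icc_self ht)
      _ < ⊤ := by
          rw [setLIntegral_const]
          exact ENNReal.mul_lt_top (ENNReal.mul_lt_top ENNReal.ofReal_lt_top ENNReal.coe_lt_top) hvol
  have hpu : ∫⁻ t in Ioo 0 T, ∫⁻ x, ‖p t x‖ₑ * ‖u t x‖ₑ < ∞ := by
    have hle : ∀ t ∈ Icc 0 T, ∫⁻ x, ‖p t x‖ₑ * ‖u t x‖ₑ ≤ P₀ + C₀ := by
      intro t ht
      calc ∫⁻ x, ‖p t x‖ₑ * ‖u t x‖ₑ ≤ ∫⁻ x, (‖p t x‖ₑ ^ 2 + ‖u t x‖ₑ ^ 2) :=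
            lintegral_mono fun x => FluidPDE.ennreal_mul_le_sq_add_sq _ _
        _ = (∫⁻ x, ‖p t x‖ₑ ^ 2) + ∫⁻ x, ‖u t x‖ₑ ^ 2 :=
            lintegral_add_left' ((hsol.contDiff_pressure ht).continuous.aemeasurable.enorm.pow_const
              _) _
        _ ≤ P₀ + C₀ := add_le_add (hp0 t ht) (hu0 t ht)
    calc ∫⁻ t in Ioo 0 T, ∫⁻ x, ‖p t x‖ₑ * ‖u t x‖ₑ
        ≤ ∫⁻ _ in Ioo 0 T, ((P₀ : ℝ≥0∞) + C₀) :=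
          setLIntegral_mono' measurableSet_Ioo fun t ht => hle t (Ioo_subset_Icc_self ht)
      _ < ⊤ := by
          rw [setLIntegral_const]
          exact ENNReal.mul_lt_top (by simp [ENNReal.add_lt_top]) hvol
  have hf : ∫⁻ t in Ioo 0 T, ∫⁻ x, ‖(0 : ℝ → E3 → E3) t x‖ₑ * ‖u t x‖ₑ < ∞ := by simp
  have h := hsol.energyEq hT hc.1 ENNReal.coe_ne_top hM hgrad hu₃ hpu hf hs hst ht
  simpa only [Pi.zero_apply, inner_zero_left, integral_zero, intervalIntegral.integral_zero,
    add_zero] using h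

/-- In the Tao class the kinetic energy is non-increasing: `½‖u(t)‖² ≤ ½‖u(s)‖²` for
`0 ≤ s ≤ t ≤ T` (`ν ≥ 0`). [cite: Tao2011, Thm. 5.4 (i)] -/
theorem kineticEnergy_le_of_hasBoundedSobolevNormsOn (hT : 0 < T) (hν : 0 ≤ ν)
    (hsol : FluidPDE.IsClassicalNSSolutionOn (Icc 0 T) ν 0 u p)
    (hu : HasBoundedSobolevNormsOn (Icc 0 T) u)
    (hp : ∀ n : ℕ, ∃ C : ℝ≥0, ∀ t ∈ Icc 0 T, ∫⁻ x, ‖iteratedFDeriv ℝ n (p t) x‖ₑ ^ 2 ≤ C)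
    (hc : FluidPDE.ContinuousInLpOn (Icc 0 T) 2 u) {s t : ℝ} (hs : 0 ≤ s) (hst : s ≤ t)
    (ht : t ≤ T) :
    VectorCalculus.kineticEnergy (u t) ≤ VectorCalculus.kineticEnergy (u s) := by
  have h := energyEq_of_hasBoundedSobolevNormsOn hT hsol hu hp hc hs hst ht
  have h0 : 0 ≤ ν * (∫⁻ τ in Ioo s t, ∫⁻ x,
      ENNReal.ofReal (FluidPDE.frobeniusNormSq (fderiv ℝ (u τ) x))).toReal :=
    mul_nonneg hν ENNReal.toReal_nonneg
  linarith

end TaoClass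

/-! ## Fast subsequences and the uniform `L²` limit -/

section Limit

/-- A Cauchy condition yields a **fast subsequence**: along `ψ` (indeed from `ψ j` on) the
increments are `≤ 2⁻ʲ` (the `ℝ≥0∞`-valued twin of the extraction in
`Literature/Probability/Process/UCPLimit.lean`, kept here to avoid a cross-topic import). [folklore] -/
theorem exists_fast_subseq {D : ℕ → ℕ → ℝ≥0∞}
    (hD : ∀ ε : ℝ≥0∞, 0 < ε → ∃ N, ∀ n ≥ N, ∀ m ≥ N, D n m ≤ ε) :
    ∃ ψ : ℕ → ℕ, StrictMono ψ ∧ ∀ j, ∀ n ≥ ψ j, ∀ m ≥ ψ j, D n m ≤ (2⁻¹ : ℝ≥0∞) ^ j := by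
  have hP : ∀ j : ℕ, ∀ᶠ N in atTop, ∀ n ≥ N, ∀ m ≥ N, D n m ≤ (2⁻¹ : ℝ≥0∞) ^ j := by
    intro j
    obtain ⟨N, hN⟩ := hD ((2⁻¹ : ℝ≥0∞) ^ j) (ENNReal.pow_pos (by norm_num) _)
    exact eventually_atTop.2 ⟨N, fun N' hN' n hn m hm => hN n (hN'.trans hn) m (hN'.trans hm)⟩
  obtain ⟨ψ, hψm, hψ⟩ := extraction_forall_of_eventually hP
  exact ⟨ψ, hψm, hψ⟩

variable {T : ℝ} {u : ℕ → ℝ → E3 → E3} {u₀ : E3 → E3}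

set_option maxHeartbeats 800000 in
/-- **The uniform `L²` limit** (Robinson–Rodrigo–Sadowski 2016, proof of Thm. 4.10, extraction
step; Ożański–Pooley 2018, proof of Thm. 6.37, Step 3). If the slices `uⁿ(t) ∈ L²`,
`t ∈ [0, T]`, of jointly continuous fields are uniformly Cauchy in `L²` and `uⁿ(0) → u₀` in
`L²`, then there is a field `v` with `v 0 = u₀`, given for `t ≠ 0` by a strongly measurable
space–time field (the pointwise limit of a fast subsequence), with `v(t) ∈ L²` and
`sup_{t ∈ [0,T]} ‖uⁿ(t) - v(t)‖₂ → 0`. [cite: RobinsonRodrigoSadowski2016, proof of Thm. 4.10] -/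
theorem exists_uniform_l2_limit (hcont : ∀ n, ContinuousOn (uncurry (u n)) (Icc 0 T ×ˢ univ))
    (hmem : ∀ n, ∀ t ∈ Icc 0 T, MemLp (u n t) 2 volume) (hu₀ : MemLp u₀ 2 volume)
    (h0 : Tendsto (fun n => eLpNorm (u n 0 - u₀) 2 volume) atTop (𝓝 0))
    (hcau : ∀ ε : ℝ≥0∞, 0 < ε → ∃ N, ∀ n ≥ N, ∀ m ≥ N, ∀ t ∈ Icc 0 T,
      eLpNorm (u n t - u m t) 2 volume ≤ ε) :
    ∃ v : ℝ → E3 → E3, v 0 = u₀ ∧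
      (∃ V : ℝ × E3 → E3, StronglyMeasurable V ∧ ∀ t, t ≠ 0 → v t = fun x => V (t, x)) ∧
      (∀ t ∈ Icc 0 T, MemLp (v t) 2 volume) ∧
      ∀ ε : ℝ≥0∞, 0 < ε → ∃ N, ∀ n ≥ N, ∀ t ∈ Icc 0 T, eLpNorm (u n t - v t) 2 volume ≤ ε := by
  -- fast subsequence
  obtain ⟨ψ, hψm, hψ⟩ := exists_fast_subseq (D := fun n m => ⨆ t ∈ Icc 0 T, eLpNorm (u n t - u m t) 2 volume)
    (fun ε hε => by
      obtain ⟨N, hN⟩ := hcau ε hε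
      exact ⟨N, fun n hn m hm => iSup₂_le fun t ht => hN n hn m hm t ht⟩)
  have hψ' : ∀ j, ∀ n ≥ ψ j, ∀ m ≥ ψ j, ∀ t ∈ Icc 0 T,
      eLpNorm (u n t - u m t) 2 volume ≤ (2⁻¹ : ℝ≥0∞) ^ j := fun j n hn m hm t ht =>
    (le_iSup₂ (f := fun t (_ : t ∈ Icc 0 T) => eLpNorm (u n t - u m t) 2 volume) t ht).trans
      (hψ j n hn m hm)
  -- measurable modifications and the pointwise limit
  set Uc : ℕ → ℝ × E3 → E3 := fun n => (Icc 0 T ×ˢ (univ : Set E3)).indicator (uncurry (u n)) with hUc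
  have hmeasU : ∀ n, Measurable (Uc n) := by
    intro n
    classical
    have h := (hcont n).measurable_piecewise (continuousOn_const (c := (0 : E3)))
      (measurableSet_Icc.prod MeasurableSet.univ)
    have he : ((Icc 0 T ×ˢ (univ : Set E3)).piecewise (uncurry (u n)) fun _ => (0 : E3)) = Uc n := by
      funext z
      by_cases hz : z ∈ Icc 0 T ×ˢ (univ : Set E3)
      · rw [Set.piecewise_eq_of_mem _ _ _ hz]; exact (Set.indicator_of_mem hz _).symm
      · rw [Set.piecewise_eq_of_notMem _ _ _ hz]; exact (Set.indicator_of_notMem hz _).symm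
    rwa [he] at h
  have hUc_eq : ∀ n t, t ∈ Icc 0 T → ∀ x, Uc n (t, x) = u n t x := fun n t ht x => by
    simp only [hUc, Set.indicator_of_mem (show (t, x) ∈ Icc 0 T ×ˢ (univ : Set E3) from ⟨ht, trivial⟩),
      uncurry_apply_pair]
  set V : ℝ × E3 → E3 := fun z => limUnder atTop (fun j => Uc (ψ j) z) with hVdef
  have hV : StronglyMeasurable V :=
    StronglyMeasurable.limUnder (l := atTop) fun j => (hmeasU (ψ j)).stronglyMeasurable
  set v : ℝ → E3 → E3 := fun t x => if t = 0 then u₀ x else V (t, x) with hvdef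
  have hv0 : v 0 = u₀ := by funext x; simp [hvdef]
  have hvt : ∀ t, t ≠ 0 → v t = fun x => V (t, x) := fun t ht => by funext x; simp [hvdef, ht]
  -- geometric bounds
  have hne0 : ∀ j : ℕ, (2⁻¹ : ℝ≥0∞) ^ j ≠ 0 := fun j => pow_ne_zero _ (ENNReal.inv_ne_zero.2 (by simp))
  have hnetop : ∀ j : ℕ, (2⁻¹ : ℝ≥0∞) ^ j ≠ ⊤ := fun j => ENNReal.pow_ne_top (ENNReal.inv_ne_top.2 (by simp))
  set B : ℕ → ℝ≥0∞ := fun j => 2 * (2⁻¹ : ℝ≥0∞) ^ j with hBdef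
  have hB : ∑' j, B j ≠ ∞ := by
    simp only [hBdef]
    rw [ENNReal.tsum_mul_left, ENNReal.tsum_geometric, ENNReal.one_sub_inv_two, inv_inv]
    exact ENNReal.mul_ne_top (by simp) (by simp)
  have hlt : ∀ j : ℕ, (2⁻¹ : ℝ≥0∞) ^ j < B j := fun j => by
    calc (2⁻¹ : ℝ≥0∞) ^ j = (2⁻¹ : ℝ≥0∞) ^ j * 1 := (mul_one _).symm
      _ < (2⁻¹ : ℝ≥0∞) ^ j * 2 := ENNReal.mul_lt_mul_right (hne0 j) (hnetop j) ENNReal.one_lt_two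
      _ = 2 * (2⁻¹ : ℝ≥0∞) ^ j := mul_comm _ _
  -- convergence along `ψ` at every `t ∈ (0, T]`
  have hconvψ : ∀ t ∈ Icc 0 T, t ≠ 0 →
      Tendsto (fun j => eLpNorm (u (ψ j) t - v t) 2 volume) atTop (𝓝 0) := by
    intro t ht ht0
    have hf : ∀ j, AEStronglyMeasurable (u (ψ j) t) volume := fun j => (hmem (ψ j) t ht).1
    have h_cau : ∀ N n m : ℕ, N ≤ n → N ≤ m →
        eLpNorm (u (ψ n) t - u (ψ m) t) 2 volume < B N := fun N n m hn hm =>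
      (hψ' N (ψ n) (hψm.monotone hn) (ψ m) (hψm.monotone hm) t ht).trans_lt (hlt N)
    have hae : ∀ᵐ x ∂(volume : Measure E3), ∃ l : E3,
        Tendsto (fun n => u (ψ n) t x) atTop (𝓝 l) :=
      MeasureTheory.Lp.ae_tendsto_of_cauchy_eLpNorm hf one_le_two hB h_cau
    have hlim : ∀ᵐ x ∂(volume : Measure E3), Tendsto (fun n => u (ψ n) t x) atTop (𝓝 (v t x)) := by
      filter_upwards [hae] with x hx
      have heq : (fun n => u (ψ n) t x) = fun j => Uc (ψ j) (t, x) := by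
        funext j; exact (hUc_eq (ψ j) t ht x).symm
      rw [hvt t ht0]
      show Tendsto (fun n => u (ψ n) t x) atTop (𝓝 (limUnder atTop (fun j => Uc (ψ j) (t, x))))
      rw [heq] at hx ⊢
      exact tendsto_nhds_limUnder hx
    exact MeasureTheory.Lp.cauchy_tendsto_of_tendsto hf (v t) hB h_cau hlim
  -- convergence along `ψ` at every `t ∈ [0, T]`
  have hconvψ' : ∀ t ∈ Icc 0 T, Tendsto (fun j => eLpNorm (u (ψ j) t - v t) 2 volume) atTop (𝓝 0) := by
    intro t ht
    by_cases ht0 : t = 0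
    · subst ht0; rw [hv0]; exact h0.comp hψm.tendsto_atTop
    · exact hconvψ t ht ht0
  -- `v t ∈ L²`
  have hvmeas : ∀ t, AEStronglyMeasurable (v t) (volume : Measure E3) := by
    intro t
    by_cases ht0 : t = 0
    · subst ht0; rw [hv0]; exact hu₀.1
    · rw [hvt t ht0]
      exact (hV.comp_measurable (measurable_const.prodMk measurable_id)).aestronglyMeasurable
  have hvmem : ∀ t ∈ Icc 0 T, MemLp (v t) 2 volume := fun t ht =>
    MeasureTheory.Lp.memLp_of_cauchy_tendsto one_le_two (fun j => hmem (ψ j) t ht) (v t) (hvmeas t)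
      (hconvψ' t ht)
  -- uniform convergence of the whole sequence
  refine ⟨v, hv0, ⟨V, hV, hvt⟩, hvmem, fun ε hε => ?_⟩
  obtain ⟨j, hj⟩ : ∃ j : ℕ, (2⁻¹ : ℝ≥0∞) ^ j ≤ ε / 2 := by
    have h := ENNReal.tendsto_atTop_zero.1
      (ENNReal.tendsto_pow_atTop_nhds_zero_of_lt_one (r := (2⁻¹ : ℝ≥0∞)) (by norm_num)) (ε / 2)
      (ENNReal.half_pos hε.ne')
    exact ⟨_, h.choose_spec _ le_rfl⟩
  refine ⟨ψ j, fun n hn t ht => ?_⟩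
  -- `‖uⁿ t - v t‖ ≤ ‖uⁿ t - u^{ψ m} t‖ + ‖u^{ψ m} t - v t‖ ≤ 2⁻ʲ + o(1)`
  have hle : ∀ m ≥ j, eLpNorm (u n t - v t) 2 volume ≤
      (2⁻¹ : ℝ≥0∞) ^ j + eLpNorm (u (ψ m) t - v t) 2 volume := by
    intro m hm
    have hsplit : u n t - v t = (u n t - u (ψ m) t) + (u (ψ m) t - v t) := by abel
    rw [hsplit]
    refine (eLpNorm_add_le (((hmem n t ht).1).sub (hmem (ψ m) t ht).1)
      (((hmem (ψ m) t ht).1).sub (hvmeas t)) one_le_two).trans ?_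
    gcongr
    exact hψ' j n hn (ψ m) (hψm.monotone hm) t ht
  have hlim : Tendsto (fun m => (2⁻¹ : ℝ≥0∞) ^ j + eLpNorm (u (ψ m) t - v t) 2 volume) atTop
      (𝓝 ((2⁻¹ : ℝ≥0∞) ^ j + 0)) := tendsto_const_nhds.add (hconvψ' t ht)
  have h := ge_of_tendsto hlim (eventually_atTop.2 ⟨j, hle⟩)
  rw [add_zero] at h
  calc eLpNorm (u n t - v t) 2 volume ≤ (2⁻¹ : ℝ≥0∞) ^ j := h
    _ ≤ ε / 2 := hj
    _ ≤ ε := ENNReal.half_le_self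

/-- Uniform convergence gives convergence at every time. [folklore] -/
theorem tendsto_eLpNorm_of_uniform {v : ℝ → E3 → E3}
    (hunif : ∀ ε : ℝ≥0∞, 0 < ε → ∃ N, ∀ n ≥ N, ∀ t ∈ Icc 0 T, eLpNorm (u n t - v t) 2 volume ≤ ε)
    {t : ℝ} (ht : t ∈ Icc 0 T) : Tendsto (fun n => eLpNorm (u n t - v t) 2 volume) atTop (𝓝 0) := by
  refine ENNReal.tendsto_atTop_zero.2 fun ε hε => ?_
  obtain ⟨N, hN⟩ := hunif ε hε
  exact ⟨N, fun n hn => hN n hn t ht⟩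

/-- **The uniform `L²` limit of `C([0,T]; L²)` fields is in `C([0,T]; L²)`**. [folklore] -/
theorem continuousInLpOn_of_uniform {v : ℝ → E3 → E3} (hc : ∀ n, FluidPDE.ContinuousInLpOn (Icc 0 T) 2 (u n))
    (hvmem : ∀ t ∈ Icc 0 T, MemLp (v t) 2 volume)
    (hunif : ∀ ε : ℝ≥0∞, 0 < ε → ∃ N, ∀ n ≥ N, ∀ t ∈ Icc 0 T, eLpNorm (u n t - v t) 2 volume ≤ ε) :
    FluidPDE.ContinuousInLpOn (Icc 0 T) 2 v := by
  refine ⟨hvmem, fun t₀ ht₀ => ?_⟩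
  refine ENNReal.tendsto_nhds_zero.2 fun ε hε => ?_
  have hε3 : 0 < ε / 3 := ENNReal.div_pos hε.ne' (by simp)
  obtain ⟨N, hN⟩ := hunif (ε / 3) hε3
  have hcN := ENNReal.tendsto_nhds_zero.1 ((hc N).2 t₀ ht₀) (ε / 3) hε3
  filter_upwards [hcN, eventually_mem_nhdsWithin] with t ht htS
  have hsplit : v t - v t₀ = (v t - u N t) + ((u N t - u N t₀) + (u N t₀ - v t₀)) := by abel
  rw [hsplit]
  have m1 : AEStronglyMeasurable (v t - u N t) volume := (hvmem t htS).1.sub ((hc N).1 t htS).1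
  have m2 : AEStronglyMeasurable (u N t - u N t₀) volume := ((hc N).1 t htS).1.sub ((hc N).1 t₀ ht₀).1
  have m3 : AEStronglyMeasurable (u N t₀ - v t₀) volume := ((hc N).1 t₀ ht₀).1.sub (hvmem t₀ ht₀).1
  calc eLpNorm ((v t - u N t) + ((u N t - u N t₀) + (u N t₀ - v t₀))) 2 volume
      ≤ eLpNorm (v t - u N t) 2 volume + (eLpNorm (u N t - u N t₀) 2 volume +
          eLpNorm (u N t₀ - v t₀) 2 volume) :=
        (eLpNorm_add_le m1 (m2.add m3) one_le_two).trans (by gcongr; exact eLpNorm_add_le m2 m3 one_le_two)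
    _ ≤ ε / 3 + (ε / 3 + ε / 3) := by
        gcongr
        · rw [eLpNorm_sub_comm]; exact hN N le_rfl t htS
        · exact hN N le_rfl t₀ ht₀
    _ = ε := by rw [← add_assoc]; exact ENNReal.add_thirds ε

end Limit

/-! ## Energies and dissipations along strong limits -/

section EnergyLimit

/-- **Passing to the limit in the energy identity** (Robinson–Rodrigo–Sadowski 2016, proof of
Thm. 4.10, energy inequality step; Ożański–Pooley 2018, proof of Thm. 6.37, Step 3): if
`aₙ + ν Dₙ = bₙ` with `aₙ → A`, `bₙ → B`, `Dₙ < ∞` and `D ≤ lim inf Dₙ`, then `A + ν D ≤ B`. [cite: RobinsonRodrigoSadowski2016, proof of Thm. 4.10] -/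
theorem energy_ineq_of_limit {ν : ℝ} (hν : 0 < ν) {a b : ℕ → ℝ} {A B : ℝ} {D : ℕ → ℝ≥0∞}
    {Dl : ℝ≥0∞} (hE : ∀ n, a n + ν * (D n).toReal = b n) (hD : ∀ n, D n ≠ ∞)
    (ha : Tendsto a atTop (𝓝 A)) (hb : Tendsto b atTop (𝓝 B)) (hDl : Dl ≤ liminf D atTop) :
    A + ν * Dl.toReal ≤ B := by
  have hDeq : ∀ n, (D n).toReal = (b n - a n) / ν := fun n => by
    field_simp; linarith [hE n]
  have hDt : Tendsto (fun n => (D n).toReal) atTop (𝓝 ((B - A) / ν)) := by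
    simp_rw [hDeq]; exact (hb.sub ha).div_const ν
  have hL0 : 0 ≤ (B - A) / ν := ge_of_tendsto' hDt fun n => ENNReal.toReal_nonneg
  have hDt' : Tendsto D atTop (𝓝 (ENNReal.ofReal ((B - A) / ν))) := by
    have h := (ENNReal.continuous_ofReal.tendsto _).comp hDt
    refine h.congr fun n => ?_
    simp [ENNReal.ofReal_toReal (hD n)]
  rw [hDt'.liminf_eq] at hDl
  have hfin : Dl ≠ ∞ := ne_top_of_le_ne_top ENNReal.ofReal_ne_top hDl
  have hle : Dl.toReal ≤ (B - A) / ν := by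
    have := ENNReal.toReal_mono ENNReal.ofReal_ne_top hDl
    rwa [ENNReal.toReal_ofReal hL0] at this
  calc A + ν * Dl.toReal ≤ A + ν * ((B - A) / ν) := by gcongr
    _ = B := by field_simp; ring

/-- **Fatou in time**: slice-wise lower bounds integrate. [folklore] -/
theorem setLIntegral_le_liminf_of_forall_le {F : ℕ → ℝ → ℝ≥0∞} {Gf : ℝ → ℝ≥0∞} {s t : ℝ}
    (hmeas : ∀ n, AEMeasurable (F n) (volume.restrict (Ioo s t)))
    (hle : ∀ τ ∈ Ioo s t, Gf τ ≤ liminf (fun n => F n τ) atTop) :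
    ∫⁻ τ in Ioo s t, Gf τ ≤ liminf (fun n => ∫⁻ τ in Ioo s t, F n τ) atTop :=
  (setLIntegral_mono' measurableSet_Ioo fun τ hτ => hle τ hτ).trans (lintegral_liminf_le' hmeas)

/-- The product Lebesgue measure restricted to a strip: the `E := ℝ³` instance of
`volume_restrict_strip` (`HeatDuhamelSmooth.lean`, outside this file's import closure; a local
copy is kept to avoid importing the heat-kernel development). [folklore] -/
theorem volume_restrict_strip_fin3 (I : Set ℝ) :
    (volume : Measure (ℝ × E3)).restrict (I ×ˢ (univ : Set E3)) =
      (volume.restrict I).prod (volume : Measure E3) := by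
  conv_rhs => rw [← Measure.restrict_univ (μ := (volume : Measure E3))]
  rw [Measure.prod_restrict]; rfl

variable {ν T : ℝ} {w : ℝ → E3 → E3} {q : ℝ → E3 → ℝ}

/-- In the Tao class the slice dissipation `τ ↦ ∫⁻ |∇u(τ)|²` is a.e.-measurable on every
`(s, t) ⊆ [0, T]` (joint continuity of `∇u` and Tonelli). [folklore] -/
theorem aemeasurable_lintegral_frobeniusNormSq (hT : 0 < T)
    (hsol : FluidPDE.IsClassicalNSSolutionOn (Icc 0 T) ν 0 w q) {s t : ℝ} (hs : 0 ≤ s) (ht : t ≤ T) :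
    AEMeasurable (fun τ => ∫⁻ x, ENNReal.ofReal (FluidPDE.frobeniusNormSq (fderiv ℝ (w τ) x)))
      (volume.restrict (Ioo s t)) := by
  have hU : UniqueDiffOn ℝ (Icc 0 T) := uniqueDiffOn_Icc hT
  have cDu : ContinuousOn (fun z : ℝ × E3 => fderiv ℝ (w z.1) z.2) (Ioo s t ×ˢ univ) :=
    (hsol.smooth_velocity.fderiv_slice hU).continuousOn.mono
      (prod_mono ((Ioo_subset_Icc_self).trans (Icc_subset_Icc hs ht)) Subset.rfl)
  have cF : ContinuousOn (fun z : ℝ × E3 => ENNReal.ofReal (FluidPDE.frobeniusNormSq (fderiv ℝ (w z.1) z.2)))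
      (Ioo s t ×ˢ univ) :=
    (ENNReal.continuous_ofReal.comp LerayHopfProofs.continuous_frobeniusNormSq).comp_continuousOn cDu
  have hF : AEMeasurable (fun z : ℝ × E3 => ENNReal.ofReal (FluidPDE.frobeniusNormSq (fderiv ℝ (w z.1) z.2)))
      ((volume.restrict (Ioo s t)).prod (volume : Measure E3)) := by
    rw [← volume_restrict_strip_fin3]
    exact cF.aemeasurable (measurableSet_Ioo.prod MeasurableSet.univ)
  exact hF.lintegral_prod_right'

end EnergyLimit

/-! ## The limit is a Leray–Hopf weak solution -/

section Assembly

variable {ν T : ℝ} {u : ℕ → ℝ → E3 → E3} {p : ℕ → ℝ → E3 → ℝ} {u₀ : E3 → E3}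

/-- The tested slice quantity of the pressure-free weak formulation (no force). [folklore] -/
def testedSlice (ν : ℝ) (w : E3 → E3) (ψ : ℝ → E3 → E3) (t : ℝ) : ℝ :=
  ∫ x, (⟪w x, FluidPDE.timeDeriv ψ t x⟫ + ⟪w x, FluidPDE.convect w (ψ t) x⟫ + ν * ⟪w x, Δ (ψ t) x⟫)

/-- **Strong `L²` convergence passes to the limit in the tested slice quantity** (the weak
formulation is linear in the test field and quadratic in `u` only through `∫⟪u, (u·∇)ψ⟫`,
continuous on `L² × L²` for bounded `∇ψ`; Ożański–Pooley 2018, proof of Thm. 6.37, Step 4). [cite: OzanskiPooley2018, proof of Thm. 6.37 Step 4] -/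
theorem tendsto_testedSlice {f : ℕ → E3 → E3} {g : E3 → E3} (hf : ∀ n, MemLp (f n) 2 volume)
    (hg : MemLp g 2 volume) (h : Tendsto (fun n => eLpNorm (f n - g) 2 volume) atTop (𝓝 0))
    {ψ : ℝ → E3 → E3} (hψ : FluidPDE.IsSpaceTimeTestOn (⊤ : Opens (ℝ × E3)) ψ) (t : ℝ) :
    Tendsto (fun n => testedSlice ν (f n) ψ t) atTop (𝓝 (testedSlice ν g ψ t)) := by
  have ht1 : MemLp (FluidPDE.timeDeriv ψ t) 2 volume := (isTestFunctionOn_slice hψ.timeDeriv_top t).memLp_volume 2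
  have ht3 : MemLp (Δ (ψ t)) 2 volume := (isTestFunctionOn_slice hψ.laplacian_top t).memLp_volume 2
  have hsl := isTestFunctionOn_slice hψ t
  have hsplit : ∀ {w : E3 → E3} (hw : MemLp w 2 volume), testedSlice ν w ψ t =
      (∫ x, ⟪w x, FluidPDE.timeDeriv ψ t x⟫) + (∫ x, ⟪w x, fderiv ℝ (ψ t) x (w x)⟫) +
        ν * ∫ x, ⟪w x, Δ (ψ t) x⟫ := by
    intro w hw
    have i1 : Integrable (fun x => ⟪w x, FluidPDE.timeDeriv ψ t x⟫) volume :=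
      FluidPDE.integrable_inner_of_memLp_two hw ht1
    have i2 : Integrable (fun x => ⟪w x, fderiv ℝ (ψ t) x (w x)⟫) volume :=
      FluidPDE.integrable_inner_fderiv_apply_of_memLp_two hw hw hsl
    have i3 : Integrable (fun x => ν * ⟪w x, Δ (ψ t) x⟫) volume :=
      (FluidPDE.integrable_inner_of_memLp_two hw ht3).const_mul ν
    have i12 : Integrable (fun x => ⟪w x, FluidPDE.timeDeriv ψ t x⟫ + ⟪w x, fderiv ℝ (ψ t) x (w x)⟫) volume :=
      i1.add i2
    unfold testedSlice FluidPDE.convect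
    rw [integral_add i12 i3, integral_add i1 i2, MeasureTheory.integral_const_mul]
  rw [hsplit hg]
  have hlim := ((tendsto_integral_inner_of_tendsto_eLpNorm hf hg ht1 h).add
    (tendsto_integral_inner_fderiv_apply hf hf hg hg hsl h h)).add
    ((tendsto_integral_inner_of_tendsto_eLpNorm hf hg ht3 h).const_mul ν)
  refine hlim.congr fun n => ?_
  rw [hsplit (hf n)]

/-- **Uniform bound of the tested slice quantity** by the kinetic energy. [folklore] -/
theorem exists_abs_testedSlice_le (hν : 0 ≤ ν) {ψ : ℝ → E3 → E3}
    (hψ : FluidPDE.IsSpaceTimeTestOn (⊤ : Opens (ℝ × E3)) ψ) (M : ℝ) :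
    ∃ C : ℝ, ∀ w : E3 → E3, MemLp w 2 volume → VectorCalculus.kineticEnergy w ≤ M →
      ∀ t, |testedSlice ν w ψ t| ≤ C := by
  obtain ⟨B₁, hB₁⟩ := exists_kineticEnergy_slice_le hψ.timeDeriv_top
  obtain ⟨B₃, hB₃⟩ := exists_kineticEnergy_slice_le hψ.laplacian_top
  obtain ⟨Cd, hCd⟩ := exists_norm_fderiv_slice_le hψ
  refine ⟨(M + B₁) + Cd * (M + M) + ν * (M + B₃), fun w hw hwM t => ?_⟩
  have ht1 : MemLp (FluidPDE.timeDeriv ψ t) 2 volume := (isTestFunctionOn_slice hψ.timeDeriv_top t).memLp_volume 2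
  have ht3 : MemLp (Δ (ψ t)) 2 volume := (isTestFunctionOn_slice hψ.laplacian_top t).memLp_volume 2
  have hsl := isTestFunctionOn_slice hψ t
  have i1 : Integrable (fun x => ⟪w x, FluidPDE.timeDeriv ψ t x⟫) volume :=
    FluidPDE.integrable_inner_of_memLp_two hw ht1
  have i2 : Integrable (fun x => ⟪w x, fderiv ℝ (ψ t) x (w x)⟫) volume :=
    FluidPDE.integrable_inner_fderiv_apply_of_memLp_two hw hw hsl
  have i3 : Integrable (fun x => ν * ⟪w x, Δ (ψ t) x⟫) volume :=
    (FluidPDE.integrable_inner_of_memLp_two hw ht3).const_mul ν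
  have i12 : Integrable (fun x => ⟪w x, FluidPDE.timeDeriv ψ t x⟫ + ⟪w x, fderiv ℝ (ψ t) x (w x)⟫) volume :=
    i1.add i2
  unfold testedSlice FluidPDE.convect
  rw [integral_add i12 i3, integral_add i1 i2, MeasureTheory.integral_const_mul]
  have e1 : |∫ x, ⟪w x, FluidPDE.timeDeriv ψ t x⟫| ≤ M + B₁ :=
    (FluidPDE.abs_integral_inner_le_kineticEnergy_add hw ht1).trans (add_le_add hwM (hB₁ t))
  have e2 : |∫ x, ⟪w x, fderiv ℝ (ψ t) x (w x)⟫| ≤ Cd * (M + M) := by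
    refine (abs_integral_inner_fderiv_apply_le_add hw hw (hCd t)).trans ?_
    have hCd0 : 0 ≤ Cd := (norm_nonneg _).trans (hCd t 0)
    gcongr
  have e3 : |ν * ∫ x, ⟪w x, Δ (ψ t) x⟫| ≤ ν * (M + B₃) := by
    rw [abs_mul, abs_of_nonneg hν]
    gcongr
    exact (FluidPDE.abs_integral_inner_le_kineticEnergy_add hw ht3).trans (add_le_add hwM (hB₃ t))
  calc |(∫ x, ⟪w x, FluidPDE.timeDeriv ψ t x⟫) + (∫ x, ⟪w x, fderiv ℝ (ψ t) x (w x)⟫) +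
        ν * ∫ x, ⟪w x, Δ (ψ t) x⟫|
      ≤ |∫ x, ⟪w x, FluidPDE.timeDeriv ψ t x⟫| + |∫ x, ⟪w x, fderiv ℝ (ψ t) x (w x)⟫| +
          |ν * ∫ x, ⟪w x, Δ (ψ t) x⟫| := abs_add_three _ _ _
    _ ≤ (M + B₁) + Cd * (M + M) + ν * (M + B₃) := add_le_add (add_le_add e1 e2) e3

/-- In the Tao class the tested slice quantity is a.e. strongly measurable in time on `(0, T)`
(joint continuity and Fubini). [folklore] -/
theorem aestronglyMeasurable_testedSlice {w : ℝ → E3 → E3}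
    (hcont : ContinuousOn (uncurry w) (Icc 0 T ×ˢ univ)) {ψ : ℝ → E3 → E3}
    (hψ : FluidPDE.IsSpaceTimeTestOn (⊤ : Opens (ℝ × E3)) ψ) :
    AEStronglyMeasurable (fun t => testedSlice ν (w t) ψ t) (volume.restrict (Ioo (0 : ℝ) T)) := by
  have hU : ContinuousOn (fun z : ℝ × E3 => w z.1 z.2) (Ioo 0 T ×ˢ univ) :=
    hcont.mono (prod_mono Ioo_subset_Icc_self Subset.rfl)
  have h1 : Continuous fun z : ℝ × E3 => FluidPDE.timeDeriv ψ z.1 z.2 := hψ.timeDeriv_top.continuous_uncurry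
  have h2 : Continuous fun z : ℝ × E3 => fderiv ℝ (ψ z.1) z.2 := hψ.fderiv_top.continuous_uncurry
  have h3 : Continuous fun z : ℝ × E3 => Δ (ψ z.1) z.2 := hψ.laplacian_top.continuous_uncurry
  have hconv : ContinuousOn (fun z : ℝ × E3 => fderiv ℝ (ψ z.1) z.2 (w z.1 z.2)) (Ioo 0 T ×ˢ univ) :=
    isBoundedBilinearMap_apply.continuous.comp_continuousOn (h2.continuousOn.prodMk hU)
  have hI : ContinuousOn (fun z : ℝ × E3 => ⟪w z.1 z.2, FluidPDE.timeDeriv ψ z.1 z.2⟫ +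
      ⟪w z.1 z.2, FluidPDE.convect (w z.1) (ψ z.1) z.2⟫ + ν * ⟪w z.1 z.2, Δ (ψ z.1) z.2⟫) (Ioo 0 T ×ˢ univ) := by
    unfold FluidPDE.convect
    exact ((hU.inner h1.continuousOn).add (hU.inner hconv)).add
      (continuousOn_const.mul (hU.inner h3.continuousOn))
  have h := hI.aestronglyMeasurable (μ := (volume : Measure (ℝ × E3))) (measurableSet_Ioo.prod MeasurableSet.univ)
  rw [volume_restrict_strip_fin3] at h
  exact h.integral_prod_right'

set_option maxHeartbeats 1600000 in
/-- **Leray–Hopf solutions as uniform `L²` limits of smooth bounded-enstrophy solutions**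
(Robinson–Rodrigo–Sadowski 2016, proof of Thm. 4.10 and Thm. 6.8; Ożański–Pooley 2018, proof of
Thm. 6.37, Steps 3–4; the limit step of Tao 2013, Thm. 5.4 (ii) for `H¹` data). Let `uⁿ` be
classical solutions on `[0, T] × ℝ³` in the Tao class (bounded spatial Sobolev norms of all
orders of `uⁿ` and `pⁿ`, `uⁿ ∈ C([0,T]; L²)`) with `E(uⁿ(0)) ≤ M`, enstrophies `∫|∇uⁿ(t)|² ≤ S`,
data `uⁿ(0) → u₀` in `L²`, and uniformly Cauchy in `C([0,T]; L²)`. Then there is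
`v ∈ C([0,T]; L²)` with `v(0) = u₀`, `uⁿ(t) → v(t)` in `L²` for every `t ∈ [0, T]`, which is a
Leray–Hopf weak solution on `[0, T)` from `u₀`: the weak formulation passes to the limit by
dominated convergence in time, the energy inequalities by the energy equality of the `uⁿ`,
convergence of the kinetic energies and the Fatou bound for weak gradients of `L²` limits, and
the continuity statements by the uniform convergence. [cite: RobinsonRodrigoSadowski2016, proof of Thm. 4.10] -/
theorem exists_isLerayHopfOn_of_uniform_cauchy (hν : 0 < ν) (hT : 0 < T)
    (hsol : ∀ n, FluidPDE.IsClassicalNSSolutionOn (Icc 0 T) ν 0 (u n) (p n))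
    (hu : ∀ n, HasBoundedSobolevNormsOn (Icc 0 T) (u n))
    (hp : ∀ n (k : ℕ), ∃ C : ℝ≥0, ∀ t ∈ Icc 0 T, ∫⁻ x, ‖iteratedFDeriv ℝ k (p n t) x‖ₑ ^ 2 ≤ C)
    (hc : ∀ n, FluidPDE.ContinuousInLpOn (Icc 0 T) 2 (u n)) (hu₀ : MemLp u₀ 2 volume)
    (h0 : Tendsto (fun n => eLpNorm (u n 0 - u₀) 2 volume) atTop (𝓝 0))
    (hcau : ∀ ε : ℝ≥0∞, 0 < ε → ∃ N, ∀ n ≥ N, ∀ m ≥ N, ∀ t ∈ Icc 0 T,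
      eLpNorm (u n t - u m t) 2 volume ≤ ε)
    {M : ℝ} (hM : ∀ n, VectorCalculus.kineticEnergy (u n 0) ≤ M)
    {S : ℝ≥0} (hS : ∀ n, ∀ t ∈ Icc 0 T,
      ∫⁻ x, ENNReal.ofReal (FluidPDE.frobeniusNormSq (fderiv ℝ (u n t) x)) ≤ S) :
    ∃ v : ℝ → E3 → E3, FluidPDE.IsLerayHopfOn T ν 0 u₀ v ∧ v 0 = u₀ ∧
      FluidPDE.ContinuousInLpOn (Icc 0 T) 2 v ∧
      ∀ t ∈ Icc 0 T, Tendsto (fun n => eLpNorm (u n t - v t) 2 volume) atTop (𝓝 0) := by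
  have hmem : ∀ n, ∀ t ∈ Icc 0 T, MemLp (u n t) 2 volume := fun n => (hc n).1
  have hcont : ∀ n, ContinuousOn (uncurry (u n)) (Icc 0 T ×ˢ univ) := fun n =>
    (hsol n).smooth_velocity.continuousOn
  obtain ⟨v, hv0, ⟨V, hV, hvt⟩, hvmem, hunif⟩ := exists_uniform_l2_limit hcont hmem hu₀ h0 hcau
  have hconv : ∀ t ∈ Icc 0 T, Tendsto (fun n => eLpNorm (u n t - v t) 2 volume) atTop (𝓝 0) :=
    fun t ht => tendsto_eLpNorm_of_uniform hunif ht
  have hcv : FluidPDE.ContinuousInLpOn (Icc 0 T) 2 v := continuousInLpOn_of_uniform hc hvmem hunif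
  have h0I : (0 : ℝ) ∈ Icc 0 T := left_mem_Icc.2 hT.le
  -- kinetic energies
  have hkin : ∀ t ∈ Icc 0 T, Tendsto (fun n => VectorCalculus.kineticEnergy (u n t)) atTop
      (𝓝 (VectorCalculus.kineticEnergy (v t))) := fun t ht =>
    tendsto_kineticEnergy_of_tendsto_eLpNorm_sub (fun n => hmem n t ht) (hvmem t ht) (hconv t ht)
  have hkinM : ∀ n, ∀ t ∈ Icc 0 T, VectorCalculus.kineticEnergy (u n t) ≤ M := fun n t ht =>
    (kineticEnergy_le_of_hasBoundedSobolevNormsOn hT hν.le (hsol n) (hu n) (hp n) (hc n) le_rfl ht.1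
      ht.2).trans (hM n)
  have hkv : ∀ t ∈ Icc 0 T, VectorCalculus.kineticEnergy (v t) ≤ M := fun t ht =>
    le_of_tendsto' (hkin t ht) fun n => hkinM n t ht
  have hM0 : 0 ≤ M := (FluidPDE.kineticEnergy_nonneg _).trans (hM 0)
  have heEv : ∀ t ∈ Icc 0 T, FluidPDE.eEnergy (v t) ≤ ENNReal.ofReal (2 * M) := fun t ht => by
    rw [FluidPDE.eEnergy_eq_ofReal (v t) (hvmem t ht)]
    exact ENNReal.ofReal_le_ofReal (by linarith [hkv t ht])
  -- measurability of the limit on the open strip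
  have hmeasv : AEStronglyMeasurable (uncurry v) ((volume : Measure (ℝ × E3)).restrict (Ioo 0 T ×ˢ univ)) := by
    refine hV.aestronglyMeasurable.congr ?_
    filter_upwards [ae_restrict_mem (measurableSet_Ioo.prod MeasurableSet.univ)] with z hz
    have hz0 : z.1 ≠ 0 := ne_of_gt (mem_prod.1 hz).1.1
    have h := congr_fun (hvt z.1 hz0) z.2
    simpa [uncurry] using h.symm
  -- weak gradients of the limit slices with the Fatou bound
  set F : ℕ → ℝ → ℝ≥0∞ := fun n τ => ∫⁻ x, ENNReal.ofReal (FluidPDE.frobeniusNormSq (fderiv ℝ (u n τ) x)) with hF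
  have hexG : ∀ t, ∃ G : E3 → E3 →L[ℝ] E3, t ∈ Icc 0 T →
      FluidPDE.HasWeakGradient (v t) G ∧
        ∫⁻ x, ENNReal.ofReal (FluidPDE.frobeniusNormSq (G x)) ≤ liminf (fun n => F n t) atTop := by
    intro t
    by_cases ht : t ∈ Icc 0 T
    · have hlim : liminf (fun n => F n t) atTop < ∞ :=
        (liminf_le_of_frequently_le' (Frequently.of_forall fun n => hS n t ht)).trans_lt
          ENNReal.coe_lt_top
      obtain ⟨G, hG, hGb⟩ := exists_hasWeakGradient_of_tendsto_eLpNorm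
        (fun n => contDiff_infty.1 ((hsol n).contDiff_velocity ht) 1) (fun n => hmem n t ht) (hvmem t ht)
        (hconv t ht) hlim
      exact ⟨G, fun _ => ⟨hG, hGb⟩⟩
    · exact ⟨0, fun h => absurd h ht⟩
  choose G hG using hexG
  have hGS : ∀ t ∈ Icc 0 T, ∫⁻ x, ENNReal.ofReal (FluidPDE.frobeniusNormSq (G t x)) ≤ S := fun t ht =>
    (hG t ht).2.trans (liminf_le_of_frequently_le' (Frequently.of_forall fun n => hS n t ht))
  -- energy inequality of the limit from every `s`
  have hEI : ∀ {s t : ℝ}, 0 ≤ s → s ≤ t → t ≤ T → VectorCalculus.kineticEnergy (v t) +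
      ν * (∫⁻ τ in Ioo s t, ∫⁻ x, ENNReal.ofReal (FluidPDE.frobeniusNormSq (G τ x))).toReal ≤
      VectorCalculus.kineticEnergy (v s) := by
    intro s t hs hst ht
    have hsI : s ∈ Icc 0 T := ⟨hs, hst.trans ht⟩
    have htI : t ∈ Icc 0 T := ⟨hs.trans hst, ht⟩
    have hE : ∀ n, VectorCalculus.kineticEnergy (u n t) + ν * (∫⁻ τ in Ioo s t, F n τ).toReal =
        VectorCalculus.kineticEnergy (u n s) := fun n =>
      energyEq_of_hasBoundedSobolevNormsOn hT (hsol n) (hu n) (hp n) (hc n) hs hst ht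
    have hD : ∀ n, (∫⁻ τ in Ioo s t, F n τ) ≠ ∞ := by
      intro n
      refine ne_top_of_le_ne_top ?_ (setLIntegral_mono' measurableSet_Ioo fun τ hτ =>
        hS n τ ⟨hs.trans hτ.1.le, hτ.2.le.trans ht⟩)
      rw [setLIntegral_const]
      exact ENNReal.mul_ne_top ENNReal.coe_ne_top measure_Ioo_lt_top.ne
    have hDl : (∫⁻ τ in Ioo s t, ∫⁻ x, ENNReal.ofReal (FluidPDE.frobeniusNormSq (G τ x))) ≤
        liminf (fun n => ∫⁻ τ in Ioo s t, F n τ) atTop :=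
      setLIntegral_le_liminf_of_forall_le
        (fun n => aemeasurable_lintegral_frobeniusNormSq hT (hsol n) hs ht)
        (fun τ hτ => (hG τ ⟨hs.trans hτ.1.le, hτ.2.le.trans ht⟩).2)
    exact energy_ineq_of_limit hν hE hD (hkin t htI) (hkin s hsI) hDl
  -- the lift of `v` to `C([0,T]; L²)` for the continuity statements
  have hfilter : 𝓝[>] (0 : ℝ) ≤ 𝓝[Icc 0 T] 0 :=
    nhdsWithin_le_of_mem (mem_of_superset (Ioo_mem_nhdsGT hT) Ioo_subset_Icc_self)
  obtain ⟨U, hUc, hUeq⟩ := hcv.exists_continuousOn_toLp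
  have hinner : ∀ {w : E3 → E3} (hw : MemLp w 2 volume) (t : ℝ) (ht : t ∈ Icc 0 T),
      ∫ x, ⟪v t x, w x⟫ = ⟪U t, hw.toLp w⟫ := by
    intro w hw t ht
    rw [MeasureTheory.L2.inner_def, hUeq t ht]
    exact integral_congr_ae (((hvmem t ht).coeFn_toLp).mp ((hw.coeFn_toLp).mono
      fun x h1 h2 => by dsimp only; rw [h1, h2]))
  -- the weak formulation
  have hweak : FluidPDE.IsWeakNSSolutionOn T ν 0 u₀ v := by
    refine ⟨hmeasv, fun K _ => ?_, ?_, fun ψ hψ hdiv => ?_⟩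
    · -- local square integrability on the strip
      have hmeas' : AEStronglyMeasurable (uncurry v) ((volume.restrict (Ioo (0 : ℝ) T)).prod (volume : Measure E3)) := by
        rw [← volume_restrict_strip_fin3]; exact hmeasv
      calc ∫⁻ z in Ioo 0 T ×ˢ K, ‖uncurry v z‖ₑ ^ 2
          ≤ ∫⁻ z in Ioo 0 T ×ˢ (univ : Set E3), ‖uncurry v z‖ₑ ^ 2 :=
            lintegral_mono_set (prod_mono subset_rfl (subset_univ _))
        _ = ∫⁻ t in Ioo 0 T, ∫⁻ x, ‖v t x‖ₑ ^ 2 ∂(volume : Measure E3) := by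
            rw [volume_restrict_strip_fin3, lintegral_prod _ (hmeas'.aemeasurable.enorm.pow_const 2)]
            rfl
        _ ≤ ∫⁻ _ in Ioo 0 T, ENNReal.ofReal (2 * M) :=
            setLIntegral_mono' measurableSet_Ioo fun t ht => heEv t (Ioo_subset_Icc_self ht)
        _ < ∞ := by
            rw [setLIntegral_const]
            exact ENNReal.mul_lt_top ENNReal.ofReal_lt_top measure_Ioo_lt_top
    · -- weakly divergence free at every `t ∈ (0, T)`
      refine (ae_restrict_iff' measurableSet_Ioo).2 (Eventually.of_forall fun t ht θ hθ => ?_)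
      have htI : t ∈ Icc 0 T := Ioo_subset_Icc_self ht
      have hgc : Continuous (gradient θ) :=
        (InnerProductSpace.toDual ℝ E3).symm.continuous.comp (hθ.contDiff.continuous_fderiv (by simp))
      have hgs : HasCompactSupport (gradient θ) :=
        (hθ.hasCompactSupport.fderiv (𝕜 := ℝ)).comp_left (map_zero _)
      have hgm : MemLp (gradient θ) 2 volume := hgc.memLp_of_hasCompactSupport hgs
      have hlim := tendsto_integral_inner_of_tendsto_eLpNorm (fun n => hmem n t htI) (hvmem t htI) hgm
        (hconv t htI)
      have hzero : ∀ n, ∫ x, ⟪u n t x, gradient θ x⟫ = 0 := fun n =>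
        VectorCalculus.IsDivFree.isWeaklyDivFree_holds ((hsol n).divFree t htI)
          (contDiff_infty.1 ((hsol n).contDiff_velocity htI) 1) θ hθ
      simp_rw [hzero] at hlim
      exact tendsto_nhds_unique hlim tendsto_const_nhds
    · -- the tested identity
      have hψ' : FluidPDE.IsSpaceTimeTestOn (⊤ : Opens (ℝ × E3)) ψ := hψ.mono le_top
      -- identities of the approximants
      have hid : ∀ n, (∫ t in Ioo 0 T, testedSlice ν (u n t) ψ t) + ∫ x, ⟪u n 0 x, ψ 0 x⟫ = 0 := by
        intro n
        have h := (isLerayHopfOn_of_hasBoundedSobolevNormsOn hT (hsol n) (hu n) (hp n) (hc n)).weak.2.2.2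
          ψ hψ hdiv
        simpa only [testedSlice, Pi.zero_apply, inner_zero_left, add_zero] using h
      -- dominated convergence in time
      obtain ⟨C, hC⟩ := exists_abs_testedSlice_le (ν := ν) hν.le hψ' M
      have hDCT : Tendsto (fun n => ∫ t in Ioo 0 T, testedSlice ν (u n t) ψ t) atTop
          (𝓝 (∫ t in Ioo 0 T, testedSlice ν (v t) ψ t)) := by
        refine tendsto_integral_of_dominated_convergence (fun _ => C) (fun n => ?_) ?_ (fun n => ?_) ?_
        · exact aestronglyMeasurable_testedSlice (hcont n) hψ'
        · exact integrableOn_const (hs := measure_Ioo_lt_top.ne) (hC := enorm_ne_top)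
        · filter_upwards [ae_restrict_mem (measurableSet_Ioo : MeasurableSet (Ioo (0 : ℝ) T))] with t ht
          rw [Real.norm_eq_abs]
          exact hC (u n t) (hmem n t (Ioo_subset_Icc_self ht)) (hkinM n t (Ioo_subset_Icc_self ht)) t
        · filter_upwards [ae_restrict_mem (measurableSet_Ioo : MeasurableSet (Ioo (0 : ℝ) T))] with t ht
          exact tendsto_testedSlice (fun n => hmem n t (Ioo_subset_Icc_self ht))
            (hvmem t (Ioo_subset_Icc_self ht)) (hconv t (Ioo_subset_Icc_self ht)) hψ' t
      have hψ0 : MemLp (ψ 0) 2 volume := (isTestFunctionOn_slice hψ' 0).memLp_volume 2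
      have hdat : Tendsto (fun n => ∫ x, ⟪u n 0 x, ψ 0 x⟫) atTop (𝓝 (∫ x, ⟪u₀ x, ψ 0 x⟫)) :=
        tendsto_integral_inner_of_tendsto_eLpNorm (fun n => hmem n 0 h0I) hu₀ hψ0 h0
      have hsum := hDCT.add hdat
      simp_rw [hid] at hsum
      have hfin : (∫ t in Ioo 0 T, testedSlice ν (v t) ψ t) + ∫ x, ⟪u₀ x, ψ 0 x⟫ = 0 :=
        (tendsto_nhds_unique tendsto_const_nhds hsum).symm
      simpa only [testedSlice, Pi.zero_apply, inner_zero_left, add_zero] using hfin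
  refine ⟨v, ⟨hweak, ⟨(2 * M).toNNReal, ?_⟩, hvmem, ⟨G, ?_, ?_, fun t ht => ?_, ?_⟩, fun w hw => ⟨?_, ?_⟩, ?_⟩,
    hv0, hcv, hconv⟩
  · -- energy bound a.e. on `(0, T)`
    exact (ae_restrict_iff' measurableSet_Ioo).2 (Eventually.of_forall fun t ht =>
      heEv t (Ioo_subset_Icc_self ht))
  · -- weak gradients a.e.
    exact (ae_restrict_iff' measurableSet_Ioo).2 (Eventually.of_forall fun t ht =>
      (hG t (Ioo_subset_Icc_self ht)).1)
  · -- the dissipation is finite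
    calc ∫⁻ t in Ioo 0 T, ∫⁻ x, ENNReal.ofReal (FluidPDE.frobeniusNormSq (G t x))
        ≤ ∫⁻ _ in Ioo 0 T, (S : ℝ≥0∞) :=
          setLIntegral_mono' measurableSet_Ioo fun t ht => hGS t (Ioo_subset_Icc_self ht)
      _ < ∞ := by
          rw [setLIntegral_const]
          exact ENNReal.mul_lt_top ENNReal.coe_lt_top measure_Ioo_lt_top
  · -- energy inequality from `0`
    have h := hEI le_rfl ht.1 ht.2
    rw [hv0] at h
    simpa only [Pi.zero_apply, inner_zero_left, integral_zero, intervalIntegral.integral_zero,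
      add_zero] using h
  · -- energy inequality from every `s ∈ (0, T)`
    refine (ae_restrict_iff' measurableSet_Ioo).2 (Eventually.of_forall fun s hs t ht => ?_)
    have h := hEI hs.1.le ht.1 ht.2
    simpa only [Pi.zero_apply, inner_zero_left, integral_zero, intervalIntegral.integral_zero,
      add_zero] using h
  · -- weak continuity on `(0, T]`
    have hcU : ContinuousOn (fun t => ⟪U t, hw.toLp w⟫) (Icc 0 T) := hUc.inner continuousOn_const
    exact (hcU.congr fun t ht => hinner hw t ht).mono Ioc_subset_Icc_self
  · -- weak attainment of the datum
    have hcU : ContinuousWithinAt (fun t => ⟪U t, hw.toLp w⟫) (Icc 0 T) 0 :=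
      (hUc.inner continuousOn_const) 0 h0I
    rw [← hv0, hinner hw 0 h0I]
    refine ((hcU.tendsto.congr' ?_).mono_left hfilter)
    exact eventually_mem_nhdsWithin.mono fun t ht => (hinner hw t ht).symm
  · -- strong attainment of the datum
    rw [← hv0]
    exact (hcv.2 0 h0I).mono_left hfilter

end Assembly

end Literature.Analysis.FluidPDE

end
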